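import Literature.NumberTheory.LFunctions.SiegelZeroLacunaryDivisorSums
import Literature.NumberTheory.LFunctions.SiegelZeroQualityBound
import Literature.NumberTheory.LFunctions.RealCharacterSmoothSums
import HarnessLib

/-!
# At a Siegel zero the harmonic sum `∑_{n ≤ N} (1∗χ)(n)/n` is flat already from `N ≥ q^{ε₁}`

Topic `Literature/NumberTheory/LFunctions`, sub-namespace `SiegelZero.HarmFlat`. Everything here is
PROVED (theorems only, no definitions, no named facts).

Let `χ` be a primitive quadratic character mod `q` with the real zero `1 − 1/(η log q)`, and put
`S(N) = ∑_{n ≤ N} (1∗χ)(n)/n` (`(1∗χ)(n) = ∑_{d ∣ n} χ(d) ≥ 0`, Mathlib's `zetaMul`). Tao–Teräväinen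
(*The Hardy–Littlewood–Chowla conjecture in the presence of a Siegel zero*, J. LMS 106 (2022), §3.3,
(3.12), (3.15), (3.16); in the tree `SiegelZero.exists_harmSum_ratio_le`) show that `S` is essentially
constant on `N ≥ q^{(1+ε)/2}`: `S(N) ≤ (1 + 4(log(N/M) + 2)/(η log q)) S(M)`. This file extends the flat
range down to `q^{ε₁}` for every fixed `ε₁ > 0`, at the price of an arbitrary constant `1 + κ` and of
`η ≥ η₀(ε₁, κ)`:

* `sum_Ioc_smooth_le` — **Rankin's trick** for the smooth part: for `w ≥ 100` and `M ≥ 1`, the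
  `w`-smooth `n > M` have `∑ (1∗χ)(n)/n ≤ e^{24} M^{−1/log w} Π₁(w)`
  (`Π₁(w) = ∏_{p<w}(1 − 1/p)⁻¹(1 − χ(p)/p)⁻¹`; the tree's `SmoothEulerProduct.hasSum_smooth` and
  `smoothProduct_rankin_le`, whose constant `e^{24}` is uniform in `χ`), and
  `Π₁(w) ≤ 2 S(M)` as soon as `e^{24} M^{−1/log w} ≤ 1/2` (`smoothProduct_le_sum_add_exp`);
* `sum_filter_dvd_le` — for a prime `p`, `∑_{n ≤ N, p ∣ n} (1∗χ)(n)/n ≤ (∑_{1 ≤ a ≤ A} (1∗χ)(p^a)/p^a) S(N)`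
  (`p^A > N`; multiplicativity), and `∑_{a ≥ 1} (1∗χ)(p^a)/p^a ≤ 3/p`, resp. `≤ 4/p²` when
  `χ(p) = −1`;
* `exists_harmSum_le_of_flatRange` — **the flat range**: for `0 < ε₁` and `0 < κ ≤ 1` there is `η₀`
  such that for `η ≥ η₀` and all naturals `q^{ε₁} ≤ M ≤ N`,
  `S(N) ≤ (1 + κ)(1 + 4(log N + 2)/(η log q)) S(M)`.
  Proof: for `M < n ≤ N₁ = ⌊q^{0.51}⌋`, either `n` is `w`-smooth, `w = ⌊q^{0.51/K}⌋ + 1`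
  (Rankin: total `≤ 2e^{24} e^{−u} S(M)` once `M ≥ w^u`), or `n` has a prime factor `p ≥ w`, and
  `∑_{w ≤ p ≤ N₁} ∑_a (1∗χ)(p^a)/p^a ≤ 3 ∑_{p* exceptional} 1/p* + 4 ∑_{p ≥ w} 1/p²` is small by
  Tao–Teräväinen's (3.14) (`TaoTeravainen2021_eq314_holds`: the exceptional primes of the bands
  `(q^{0.51/m}, q^{0.51/(m−1)}]`, `2 ≤ m ≤ K`, have `∑ 1/p* ≪ m η^{−1/m}`) and `w → ∞`
  (`η ≤ q`, `SiegelZeroQuality.exists_eta_le_level`); the range `N ≥ N₁` is Tao–Teräväinen's.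

This is the input "`F(q⁴)/F(z) ≤ C` for `z = q^{0.02}`" of the twisted log-free density estimate for
`L(s, χ)` at a Siegel zero (the Selberg-sieve denominators `G(z) ≥ S(z)` are then within a constant of
`S(q⁴) ≥ L(1,χ)(1 − β)⁻¹(1 − o(1))`).

## References

* T. Tao, J. Teräväinen, J. London Math. Soc. (2) 106 (2022), §3.3, Proposition 3.5 and its proof.
  [TaoTeravainen2021]
* R. A. Rankin, J. London Math. Soc. 13 (1938) 242–247 (Rankin's trick). [folklore]
-/

noncomputable section

open Finset Real
open Literature.NumberTheory.LFunctions

namespace Literature.NumberTheory.LFunctions.SiegelZero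

namespace HarmFlat

variable {q : ℕ} (χ : DirichletCharacter ℂ q)

/-! ### Rankin's trick for the smooth part -/

/-- **The `w`-smooth `n > M` carry little harmonic mass** (Rankin): for `w ≥ 100`, `M ≥ 1` and any `N`,
`∑_{M < n ≤ N, n w-smooth} (1∗χ)(n)/n ≤ e^{24} M^{−1/log w} ∏_{p<w}(1 − 1/p)⁻¹(1 − χ(p)/p)⁻¹`
(`1/n ≤ M^{−δ} n^{−(1−δ)}` for `n > M`, the Euler product over smooth numbers at `1 − δ`,
`δ = 1/log w`, and the tree's bound `Π_{1−δ}(w) ≤ e^{24} Π₁(w)`). [folklore] -/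
theorem sum_Ioc_smooth_le (hχ : χ ^ 2 = 1) {w : ℕ} (hw : 100 ≤ w) {M : ℕ} (hM : 1 ≤ M) (N : ℕ) :
    ∑ n ∈ (Ioc M N).filter (· ∈ w.smoothNumbers), (χ.zetaMul n).re / n ≤
      Real.exp 24 * (M : ℝ) ^ (-(1 / Real.log w)) *
        ∏ p ∈ w.primesBelow, (1 - (p : ℝ)⁻¹)⁻¹ * (1 - (χ p).re * (p : ℝ)⁻¹)⁻¹ := by
  obtain ⟨hlogw4, -⟩ := SmoothEulerProduct.log_ge_of_hundred_le hw
  set δ : ℝ := 1 / Real.log w with hδ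
  have hδ0 : 0 < δ := by rw [hδ]; positivity
  have hδ1 : δ < 1 := by
    rw [hδ, div_lt_one (by linarith)]; linarith
  have hM0 : (0 : ℝ) < M := by exact_mod_cast hM
  -- the Euler product at `1 - δ` over smooth numbers
  have hsum := SmoothEulerProduct.hasSum_smooth χ hχ (by linarith : 0 < 1 - δ) w
  have hrank := SmoothEulerProduct.smoothProduct_rankin_le χ hχ hw
  rw [← hδ] at hrank
  -- the finite set inside the smooth numbers
  set F : Finset ℕ := (Ioc M N).filter (· ∈ w.smoothNumbers) with hF
  have hmem : ∀ n ∈ F, n ∈ w.smoothNumbers := fun n hn => (mem_filter.1 hn).2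
  set T : Finset w.smoothNumbers := F.attach.map
    ⟨fun n => ⟨n.1, hmem n.1 n.2⟩, fun a b hab => Subtype.ext (by
      have := congrArg Subtype.val hab; exact this)⟩ with hT
  have hnn : ∀ m : w.smoothNumbers, 0 ≤ (χ.zetaMul m).re * ((m : ℕ) : ℝ) ^ (-(1 - δ)) := fun m =>
    mul_nonneg (SmoothEulerProduct.zetaMul_re_nonneg χ hχ _) (Real.rpow_nonneg (Nat.cast_nonneg _) _)
  have hle := sum_le_hasSum T (fun m _ => hnn m) hsum
  -- pointwise: `(1∗χ)(n)/n ≤ M^{−δ} (1∗χ)(n) n^{−(1−δ)}` for `n > M`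
  have hpt : ∀ n ∈ F, (χ.zetaMul n).re / n ≤
      (M : ℝ) ^ (-δ) * ((χ.zetaMul n).re * (n : ℝ) ^ (-(1 - δ))) := by
    intro n hn
    have hn' := (mem_Ioc.1 (mem_filter.1 hn).1)
    have hn0 : (0 : ℝ) < n := by exact_mod_cast (lt_of_le_of_lt (Nat.zero_le M) hn'.1)
    have hMn : (M : ℝ) ≤ n := by exact_mod_cast hn'.1.le
    have ha : 0 ≤ (χ.zetaMul n).re := SmoothEulerProduct.zetaMul_re_nonneg χ hχ _
    have hsplit : (n : ℝ)⁻¹ = (n : ℝ) ^ (-δ) * (n : ℝ) ^ (-(1 - δ)) := by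
      rw [← Real.rpow_add hn0, ← Real.rpow_neg_one]; ring_nf
    have hmono : (n : ℝ) ^ (-δ) ≤ (M : ℝ) ^ (-δ) :=
      Real.rpow_le_rpow_of_nonpos hM0 hMn (by linarith)
    rw [div_eq_mul_inv, hsplit]
    calc (χ.zetaMul n).re * ((n : ℝ) ^ (-δ) * (n : ℝ) ^ (-(1 - δ)))
        = (n : ℝ) ^ (-δ) * ((χ.zetaMul n).re * (n : ℝ) ^ (-(1 - δ))) := by ring
      _ ≤ (M : ℝ) ^ (-δ) * ((χ.zetaMul n).re * (n : ℝ) ^ (-(1 - δ))) :=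
          mul_le_mul_of_nonneg_right hmono (mul_nonneg ha (Real.rpow_nonneg hn0.le _))
  have hsumT : ∑ m ∈ T, (χ.zetaMul m).re * ((m : ℕ) : ℝ) ^ (-(1 - δ)) =
      ∑ n ∈ F, (χ.zetaMul n).re * (n : ℝ) ^ (-(1 - δ)) := by
    rw [hT, sum_map, ← sum_attach F]
    rfl
  calc ∑ n ∈ F, (χ.zetaMul n).re / n
      ≤ ∑ n ∈ F, (M : ℝ) ^ (-δ) * ((χ.zetaMul n).re * (n : ℝ) ^ (-(1 - δ))) := sum_le_sum hpt
    _ = (M : ℝ) ^ (-δ) * ∑ n ∈ F, (χ.zetaMul n).re * (n : ℝ) ^ (-(1 - δ)) := by rw [mul_sum]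
    _ ≤ (M : ℝ) ^ (-δ) * ∏ p ∈ w.primesBelow,
          (1 - (p : ℝ) ^ (-(1 - δ)))⁻¹ * (1 - (χ p).re * (p : ℝ) ^ (-(1 - δ)))⁻¹ := by
        rw [← hsumT]; exact mul_le_mul_of_nonneg_left hle (Real.rpow_nonneg hM0.le _)
    _ ≤ (M : ℝ) ^ (-δ) * (Real.exp 24 *
          ∏ p ∈ w.primesBelow, (1 - (p : ℝ)⁻¹)⁻¹ * (1 - (χ p).re * (p : ℝ)⁻¹)⁻¹) :=
        mul_le_mul_of_nonneg_left hrank (Real.rpow_nonneg hM0.le _)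
    _ = _ := by ring

/-- **The truncated Euler product is at most `2 S(M)`** once `e^{24} M^{−1/log w} ≤ 1/2`
(the tree's `smoothProduct_le_sum_add_exp`). [folklore] -/
theorem smoothProduct_le_two_mul (hχ : χ ^ 2 = 1) {w : ℕ} (hw : 100 ≤ w) {M : ℕ} (hM : 1 ≤ M)
    (hsmall : Real.exp 24 * (M : ℝ) ^ (-(1 / Real.log w)) ≤ 1 / 2) :
    ∏ p ∈ w.primesBelow, (1 - (p : ℝ)⁻¹)⁻¹ * (1 - (χ p).re * (p : ℝ)⁻¹)⁻¹ ≤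
      2 * ∑ n ∈ Icc 1 M, (χ.zetaMul n).re / n := by
  have h := SmoothEulerProduct.smoothProduct_le_sum_add_exp χ hχ hw hM
  set P := ∏ p ∈ w.primesBelow, (1 - (p : ℝ)⁻¹)⁻¹ * (1 - (χ p).re * (p : ℝ)⁻¹)⁻¹ with hP
  have hP0 : 0 ≤ P := by
    rw [hP]
    exact prod_nonneg fun p hp => by
      have := SmoothEulerProduct.eulerFactor_pos χ (Nat.prime_of_mem_primesBelow hp) one_pos
      simp only [Real.rpow_neg_one] at this
      exact this.le
  have : Real.exp 24 * (M : ℝ) ^ (-(1 / Real.log w)) * P ≤ 1 / 2 * P :=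
    mul_le_mul_of_nonneg_right hsmall hP0
  linarith

/-! ### The numbers with a large prime factor -/

/-- For a prime `p` and `A` with `N < p^{A+1}`:
`∑_{n ≤ N, p ∣ n} (1∗χ)(n)/n ≤ (∑_{1 ≤ a ≤ A} (1∗χ)(p^a)/p^a) · S(N)`
(write `n = p^a m`, `p ∤ m`, and use multiplicativity and positivity). [folklore] -/
theorem sum_filter_dvd_le (hχ : χ ^ 2 = 1) {p : ℕ} (hp : p.Prime) {N A : ℕ} (hA : N < p ^ (A + 1)) :
    ∑ n ∈ (Icc 1 N).filter (p ∣ ·), (χ.zetaMul n).re / n ≤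
      (∑ a ∈ Icc 1 A, (χ.zetaMul (p ^ a)).re / (p : ℝ) ^ a) *
        ∑ m ∈ Icc 1 N, (χ.zetaMul m).re / m := by
  classical
  -- the weight as a multiplicative arithmetic function
  set g : ArithmeticFunction ℝ := ⟨fun n => (χ.zetaMul n).re / n, by simp⟩ with hgdef
  have hg : ∀ n, g n = (χ.zetaMul n).re / n := fun n => rfl
  have hmult := HarmWeight.isMultiplicative (χ := χ) hχ hg
  have hg0 : ∀ n, 0 ≤ g n := HarmWeight.nonneg (χ := χ) hχ hg
  have hp1 : 1 < p := hp.one_lt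
  set S : Finset ℕ := (Icc 1 N).filter (p ∣ ·) with hS
  set v : ℕ → ℕ := fun n => n.factorization p with hv
  have hval : ∀ n ∈ S, v n ∈ Icc 1 A := by
    intro n hn
    rw [hS, mem_filter, mem_Icc] at hn
    have hn0 : n ≠ 0 := by omega
    rw [mem_Icc]
    change 1 ≤ n.factorization p ∧ n.factorization p ≤ A
    constructor
    · exact hp.factorization_pos_of_dvd hn0 hn.2
    · have hle : p ^ n.factorization p ≤ n := Nat.ordProj_le p hn0
      have hlt : p ^ n.factorization p < p ^ (A + 1) := lt_of_le_of_lt (hle.trans hn.1.2) hA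
      have := (Nat.pow_lt_pow_iff_right hp1).1 hlt
      omega
  have hfib : ∀ a : ℕ, ∀ n ∈ S.filter (fun n => v n = a),
      g n = g (p ^ a) * g (n / p ^ a) ∧ n / p ^ a ∈ Icc 1 N ∧ p ^ a ∣ n := by
    intro a n hn
    rw [mem_filter] at hn
    obtain ⟨hnS, hva⟩ := hn
    rw [hS, mem_filter, mem_Icc] at hnS
    have hn0 : n ≠ 0 := by omega
    have hdvd : p ^ a ∣ n := by rw [← hva, hv]; exact Nat.ordProj_dvd n p
    have hndvd : ¬ p ∣ n / p ^ a := by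
      rw [← hva, hv]; exact Nat.not_dvd_ordCompl hp hn0
    have hcop : (p ^ a).Coprime (n / p ^ a) :=
      Nat.Coprime.pow_left a ((Nat.Prime.coprime_iff_not_dvd hp).2 hndvd)
    have hn_eq : n = p ^ a * (n / p ^ a) := (Nat.mul_div_cancel' hdvd).symm
    refine ⟨?_, ?_, hdvd⟩
    · conv_lhs => rw [hn_eq]
      exact hmult.map_mul_of_coprime hcop
    · rw [mem_Icc]
      exact ⟨Nat.div_pos (Nat.le_of_dvd (Nat.pos_of_ne_zero hn0) hdvd) (pow_pos hp.pos a),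
        (Nat.div_le_self n _).trans hnS.1.2⟩
  rw [show ∑ n ∈ S, (χ.zetaMul n).re / n = ∑ n ∈ S, g n from rfl,
    ← Finset.sum_fiberwise_of_maps_to hval, Finset.sum_mul]
  refine Finset.sum_le_sum fun a _ => ?_
  calc ∑ n ∈ S.filter (fun n => v n = a), g n
      = ∑ n ∈ S.filter (fun n => v n = a), g (p ^ a) * g (n / p ^ a) :=
        Finset.sum_congr rfl fun n hn => (hfib a n hn).1
    _ = g (p ^ a) * ∑ n ∈ S.filter (fun n => v n = a), g (n / p ^ a) := by rw [Finset.mul_sum]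
    _ ≤ g (p ^ a) * ∑ m ∈ Icc 1 N, g m := by
        refine mul_le_mul_of_nonneg_left ?_ (hg0 _)
        have hinj : Set.InjOn (fun n => n / p ^ a) (S.filter (fun n => v n = a) : Set ℕ) := by
          intro n₁ hn₁ n₂ hn₂ h
          have hd1 := (hfib a n₁ hn₁).2.2
          have hd2 := (hfib a n₂ hn₂).2.2
          calc n₁ = p ^ a * (n₁ / p ^ a) := (Nat.mul_div_cancel' hd1).symm
            _ = p ^ a * (n₂ / p ^ a) := by rw [show n₁ / p ^ a = n₂ / p ^ a from h]
            _ = n₂ := Nat.mul_div_cancel' hd2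
        calc ∑ n ∈ S.filter (fun n => v n = a), g (n / p ^ a)
            = ∑ m ∈ (S.filter (fun n => v n = a)).image (fun n => n / p ^ a), g m :=
              (Finset.sum_image hinj).symm
          _ ≤ ∑ m ∈ Icc 1 N, g m := by
              refine Finset.sum_le_sum_of_subset_of_nonneg ?_ fun m _ _ => hg0 m
              intro m hm
              rw [Finset.mem_image] at hm
              obtain ⟨n, hn, rfl⟩ := hm
              exact (hfib a n hn).2.1
    _ = (χ.zetaMul (p ^ a)).re / (p : ℝ) ^ a * ∑ m ∈ Icc 1 N, (χ.zetaMul m).re / m := by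
        simp only [hg]; push_cast; rfl

/-- `x/(1−x)² + ((1−x)⁻¹ − 1) ≤ 8x` and `x² (1 − x)⁻¹ ≤ 2x²` for `0 ≤ x ≤ 1/2`. [folklore] -/
theorem geom_bounds {x : ℝ} (hx0 : 0 ≤ x) (hx : x ≤ 1 / 2) :
    x / (1 - x) ^ 2 + ((1 - x)⁻¹ - 1) ≤ 8 * x ∧ x ^ 2 * (1 - x)⁻¹ ≤ 2 * x ^ 2 := by
  have h1x : 1 / 2 ≤ 1 - x := by linarith
  have h1x0 : 0 < 1 - x := by linarith
  have hinv : (1 - x)⁻¹ ≤ 2 := by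
    rw [inv_le_comm₀ h1x0 (by norm_num)]; linarith
  have hinv0 : 0 < (1 - x)⁻¹ := inv_pos.2 h1x0
  constructor
  · -- `x/(1-x)^2 ≤ 4x` and `(1-x)⁻¹ - 1 = x (1-x)⁻¹ ≤ 2x`
    have h1 : x / (1 - x) ^ 2 ≤ 4 * x := by
      rw [div_eq_mul_inv, ← inv_pow]
      have : (1 - x)⁻¹ ^ 2 ≤ 4 := by nlinarith
      nlinarith
    have h2 : (1 - x)⁻¹ - 1 = x * (1 - x)⁻¹ := by field_simp; ring
    have h3 : x * (1 - x)⁻¹ ≤ x * 2 := mul_le_mul_of_nonneg_left hinv hx0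
    linarith
  · calc x ^ 2 * (1 - x)⁻¹ ≤ x ^ 2 * 2 := mul_le_mul_of_nonneg_left hinv (sq_nonneg x)
      _ = 2 * x ^ 2 := by ring

/-- **The local sums**: for a prime `p` and every `A`,
`∑_{1 ≤ a ≤ A} (1∗χ)(p^a)/p^a ≤ 8/p`, and `≤ 2/p²` when `χ(p) = −1`
(`(1∗χ)(p^a) ≤ a + 1`; when `χ(p) = −1`, `(1∗χ)(p) = 0` and `(1∗χ)(p^a) ≤ 1`). [folklore] -/
theorem sum_prime_pow_le (hχ : χ ^ 2 = 1) {p : ℕ} (hp : p.Prime) (A : ℕ) :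
    ∑ a ∈ Icc 1 A, (χ.zetaMul (p ^ a)).re / (p : ℝ) ^ a ≤ 8 / p ∧
    ((χ p).re = -1 → ∑ a ∈ Icc 1 A, (χ.zetaMul (p ^ a)).re / (p : ℝ) ^ a ≤ 2 / (p : ℝ) ^ 2) := by
  have hp2 : (2 : ℝ) ≤ p := by exact_mod_cast hp.two_le
  have hp0 : (0 : ℝ) < p := by linarith
  set x : ℝ := (p : ℝ)⁻¹ with hx
  have hx0 : 0 ≤ x := by rw [hx]; positivity
  have hxhalf : x ≤ 1 / 2 := by
    rw [hx]; exact inv_le_of_inv_le₀ (by norm_num) (by simpa using hp2)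
  have hxlt : x < 1 := by linarith
  have hpow : ∀ a : ℕ, (χ.zetaMul (p ^ a)).re / (p : ℝ) ^ a = (χ.zetaMul (p ^ a)).re * x ^ a := by
    intro a; rw [hx, inv_pow, div_eq_mul_inv]
  obtain ⟨hg1, hg2⟩ := geom_bounds hx0 hxhalf
  constructor
  · -- `≤ ∑ a x^a + ∑ x^a ≤ x/(1-x)^2 + ((1-x)⁻¹ - 1) ≤ 8x`
    have h1 := hasSum_coe_mul_geometric_of_norm_lt_one (r := x)
      (by rw [Real.norm_of_nonneg hx0]; exact hxlt)
    have h2 := hasSum_geometric_of_lt_one hx0 hxlt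
    have hle1 : ∑ a ∈ Icc 1 A, (a : ℝ) * x ^ a ≤ x / (1 - x) ^ 2 :=
      sum_le_hasSum _ (fun a _ => by positivity) h1
    have hle2 : ∑ a ∈ Icc 1 A, x ^ a ≤ (1 - x)⁻¹ - 1 := by
      have hsub : ∑ a ∈ insert 0 (Icc 1 A), x ^ a ≤ (1 - x)⁻¹ :=
        sum_le_hasSum _ (fun a _ => by positivity) h2
      rw [Finset.sum_insert (by simp), pow_zero] at hsub
      linarith
    calc ∑ a ∈ Icc 1 A, (χ.zetaMul (p ^ a)).re / (p : ℝ) ^ a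
        = ∑ a ∈ Icc 1 A, (χ.zetaMul (p ^ a)).re * x ^ a := Finset.sum_congr rfl fun a _ => hpow a
      _ ≤ ∑ a ∈ Icc 1 A, ((a : ℝ) + 1) * x ^ a := by
          refine Finset.sum_le_sum fun a _ => ?_
          exact mul_le_mul_of_nonneg_right (SmoothEulerProduct.zetaMul_prime_pow_re_le χ hχ hp a)
            (pow_nonneg hx0 a)
      _ = ∑ a ∈ Icc 1 A, (a : ℝ) * x ^ a + ∑ a ∈ Icc 1 A, x ^ a := by
          rw [← Finset.sum_add_distrib]; refine Finset.sum_congr rfl fun a _ => ?_; ring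
      _ ≤ x / (1 - x) ^ 2 + ((1 - x)⁻¹ - 1) := add_le_add hle1 hle2
      _ ≤ 8 * x := hg1
      _ = 8 / p := by rw [hx, div_eq_mul_inv]
  · intro hc
    -- `(1∗χ)(p) = 0` and `(1∗χ)(p^a) ≤ 1` for `a ≥ 2`
    have hval : ∀ a : ℕ, (χ.zetaMul (p ^ a)).re = ∑ i ∈ range (a + 1), (-1 : ℝ) ^ i := by
      intro a; rw [SmoothEulerProduct.zetaMul_prime_pow_re χ hχ hp a, hc]
    have hone : (χ.zetaMul (p ^ 1)).re = 0 := by rw [hval]; norm_num [Finset.sum_range_succ]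
    have halt : ∀ a : ℕ, ∑ i ∈ range (a + 1), (-1 : ℝ) ^ i = if Even a then 1 else 0 := by
      intro a
      induction a with
      | zero => simp
      | succ n ih =>
          rw [Finset.sum_range_succ, ih]
          rcases Nat.even_or_odd n with h | h
          · have hodd : ¬ Even (n + 1) := by rw [Nat.even_add_one]; exact not_not.2 h
            rw [if_pos h, if_neg hodd, pow_succ, h.neg_one_pow]; norm_num
          · have heven : Even (n + 1) := by rw [Nat.even_add_one]; exact Nat.not_even_iff_odd.2 h
            have hne : ¬ Even n := Nat.not_even_iff_odd.2 h
            rw [if_neg hne, if_pos heven, pow_succ, h.neg_one_pow]; norm_num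
    have hle1 : ∀ a : ℕ, (χ.zetaMul (p ^ a)).re ≤ 1 := by
      intro a; rw [hval, halt]; split_ifs <;> norm_num
    -- split off `a = 1`
    have hsplit : ∑ a ∈ Icc 1 A, (χ.zetaMul (p ^ a)).re * x ^ a ≤ ∑ a ∈ Icc 2 A, x ^ a := by
      rcases Nat.lt_or_ge A 1 with hA | hA
      · have : Icc 1 A = ∅ := Finset.Icc_eq_empty_of_lt hA
        rw [this, Finset.sum_empty]
        exact Finset.sum_nonneg fun a _ => pow_nonneg hx0 a
      · have hIcc : Icc 1 A = insert 1 (Icc 2 A) := by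
          ext a; simp only [mem_Icc, Finset.mem_insert]; omega
        rw [hIcc, Finset.sum_insert (by simp), hone, zero_mul, zero_add]
        refine Finset.sum_le_sum fun a _ => ?_
        calc (χ.zetaMul (p ^ a)).re * x ^ a ≤ 1 * x ^ a :=
              mul_le_mul_of_nonneg_right (hle1 a) (pow_nonneg hx0 a)
          _ = x ^ a := one_mul _
    -- `∑_{2 ≤ a ≤ A} x^a ≤ x² (1-x)⁻¹ ≤ 2x²`
    have hgeomtail : ∑ a ∈ Icc 2 A, x ^ a ≤ x ^ 2 * (1 - x)⁻¹ := by
      have hs : HasSum (fun a : ℕ => x ^ 2 * x ^ a) (x ^ 2 * (1 - x)⁻¹) :=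
        (hasSum_geometric_of_lt_one hx0 hxlt).mul_left (x ^ 2)
      -- reindex `Icc 2 A` as `a = b + 2`
      have hre : ∑ a ∈ Icc 2 A, x ^ a = ∑ b ∈ range (A - 1), x ^ 2 * x ^ b := by
        have : Icc 2 A = (range (A - 1)).map ⟨fun b => b + 2, add_left_injective 2⟩ := by
          ext a
          simp only [mem_Icc, Finset.mem_map, mem_range, Function.Embedding.coeFn_mk]
          constructor
          · intro h; exact ⟨a - 2, by omega, by omega⟩
          · rintro ⟨b, hb, rfl⟩; omega
        rw [this, Finset.sum_map]
        refine Finset.sum_congr rfl fun b _ => ?_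
        simp only [Function.Embedding.coeFn_mk]
        rw [pow_add]; ring
      rw [hre]
      exact sum_le_hasSum _ (fun b _ => by positivity) hs
    calc ∑ a ∈ Icc 1 A, (χ.zetaMul (p ^ a)).re / (p : ℝ) ^ a
        = ∑ a ∈ Icc 1 A, (χ.zetaMul (p ^ a)).re * x ^ a := Finset.sum_congr rfl fun a _ => hpow a
      _ ≤ ∑ a ∈ Icc 2 A, x ^ a := hsplit
      _ ≤ x ^ 2 * (1 - x)⁻¹ := hgeomtail
      _ ≤ 2 * x ^ 2 := hg2
      _ = 2 / (p : ℝ) ^ 2 := by rw [hx, inv_pow, div_eq_mul_inv]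

/-- `∑_{w ≤ n ≤ N} 1/n² ≤ 2/w` for `w ≥ 2` (telescoping `1/n² ≤ 1/(n−1) − 1/n`). [folklore] -/
theorem sum_inv_sq_Icc_le {w : ℕ} (hw : 2 ≤ w) (N : ℕ) :
    ∑ n ∈ Icc w N, (1 : ℝ) / (n : ℝ) ^ 2 ≤ 2 / w := by
  have hw1 : (1 : ℝ) ≤ (w : ℝ) - 1 := by
    have : (2 : ℝ) ≤ w := by exact_mod_cast hw
    linarith
  -- telescoping bound `∑_{w ≤ n ≤ N} 1/n² ≤ 1/(w-1) - 1/N` for `N ≥ w`, by induction on `N`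
  have key : ∀ N : ℕ, w ≤ N → ∑ n ∈ Icc w N, (1 : ℝ) / (n : ℝ) ^ 2 ≤ 1 / ((w : ℝ) - 1) - 1 / N := by
    intro N hN
    induction N, hN using Nat.le_induction with
    | base =>
        rw [Finset.Icc_self, Finset.sum_singleton]
        have hw0 : (0 : ℝ) < w := by linarith
        have hrhs : 1 / ((w : ℝ) - 1) - 1 / w = 1 / (((w : ℝ) - 1) * w) := by
          field_simp; ring
        rw [hrhs]
        exact one_div_le_one_div_of_le (by positivity) (by nlinarith)
    | succ n hn ih =>
        have hn0 : (0 : ℝ) < n := by exact_mod_cast (lt_of_lt_of_le (by omega) hn)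
        rw [← Finset.insert_Icc_right_eq_Icc_add_one (by omega), Finset.sum_insert (by simp), add_comm]
        have hstep : (1 : ℝ) / ((n + 1 : ℕ) : ℝ) ^ 2 ≤ 1 / (n : ℝ) - 1 / ((n + 1 : ℕ) : ℝ) := by
          push_cast
          rw [div_sub_div _ _ hn0.ne' (by linarith), div_le_div_iff₀ (by positivity) (by positivity)]
          nlinarith
        calc ∑ k ∈ Icc w n, (1 : ℝ) / (k : ℝ) ^ 2 + 1 / ((n + 1 : ℕ) : ℝ) ^ 2
            ≤ (1 / ((w : ℝ) - 1) - 1 / n) + (1 / (n : ℝ) - 1 / ((n + 1 : ℕ) : ℝ)) := add_le_add ih hstep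
          _ = 1 / ((w : ℝ) - 1) - 1 / ((n + 1 : ℕ) : ℝ) := by ring
  rcases lt_or_ge N w with hN | hN
  · rw [Finset.Icc_eq_empty_of_lt hN, Finset.sum_empty]; positivity
  · have h := key N hN
    have hN0 : (0 : ℝ) ≤ 1 / (N : ℝ) := by positivity
    have hw2 : (1 : ℝ) / ((w : ℝ) - 1) ≤ 2 / w := by
      have hw0 : (0 : ℝ) < w := by linarith
      rw [div_le_div_iff₀ (by linarith) hw0]; nlinarith
    linarith

/-- **The numbers with a prime factor `≥ w`.** For all `w`, `M`, `N₁`: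
`∑_{M < n ≤ N₁, n not w-smooth} (1∗χ)(n)/n ≤ (∑_{w ≤ p ≤ N₁ prime} ∑_{1 ≤ a ≤ N₁} (1∗χ)(p^a)/p^a) · S(N₁)`
(each such `n` has a prime factor `p ≥ w`; union bound over `p`, then `sum_filter_dvd_le`).
[folklore] -/
theorem sum_Ioc_rough_le (hχ : χ ^ 2 = 1) (w M N₁ : ℕ) :
    ∑ n ∈ (Ioc M N₁).filter (· ∉ w.smoothNumbers), (χ.zetaMul n).re / n ≤
      (∑ p ∈ (Icc w N₁).filter Nat.Prime, ∑ a ∈ Icc 1 N₁, (χ.zetaMul (p ^ a)).re / (p : ℝ) ^ a) *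
        ∑ m ∈ Icc 1 N₁, (χ.zetaMul m).re / m := by
  classical
  have hg0 : ∀ n : ℕ, 0 ≤ (χ.zetaMul n).re / n := fun n =>
    div_nonneg (SmoothEulerProduct.zetaMul_re_nonneg χ hχ n) (Nat.cast_nonneg n)
  -- each rough `n` has a prime factor in `[w, N₁]`
  have hcover : ∀ n ∈ (Ioc M N₁).filter (· ∉ w.smoothNumbers),
      ∃ p ∈ (Icc w N₁).filter Nat.Prime, n ∈ (Icc 1 N₁).filter (p ∣ ·) := by
    intro n hn
    rw [mem_filter, mem_Ioc] at hn
    obtain ⟨⟨hMn, hnN⟩, hns⟩ := hn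
    have hn0 : n ≠ 0 := by omega
    rw [Nat.mem_smoothNumbers'] at hns
    push Not at hns
    obtain ⟨p, hp, hpn, hwp⟩ := hns
    refine ⟨p, ?_, ?_⟩
    · rw [mem_filter, mem_Icc]
      exact ⟨⟨hwp, (Nat.le_of_dvd (Nat.pos_of_ne_zero hn0) hpn).trans hnN⟩, hp⟩
    · rw [mem_filter, mem_Icc]
      exact ⟨⟨Nat.pos_of_ne_zero hn0, hnN⟩, hpn⟩
  refine (sum_le_sum_sum_of_cover _ _ _ _ hg0 hcover).trans ?_
  rw [Finset.sum_mul]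
  refine Finset.sum_le_sum fun p hp => ?_
  have hpp : p.Prime := (mem_filter.1 hp).2
  refine sum_filter_dvd_le χ hχ hpp (A := N₁) ?_
  -- `N₁ < p^{N₁+1}`
  calc N₁ < 2 ^ N₁ := Nat.lt_two_pow_self
    _ ≤ p ^ N₁ := Nat.pow_le_pow_left hpp.two_le _
    _ ≤ p ^ (N₁ + 1) := Nat.pow_le_pow_right hpp.pos (Nat.le_succ _)

/-- **The local sums against `λ(p) = 1 + χ(p)`**: for every prime `p` and every `A`,
`∑_{1 ≤ a ≤ A} (1∗χ)(p^a)/p^a ≤ 8 λ(p)/p + 2/p²` (`λ(p) ≥ 1` unless `χ(p) = −1`).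
[folklore] -/
theorem sum_prime_pow_le_charDivisorSum (hχ : χ ^ 2 = 1) {p : ℕ} (hp : p.Prime) (A : ℕ) :
    ∑ a ∈ Icc 1 A, (χ.zetaMul (p ^ a)).re / (p : ℝ) ^ a ≤
      8 * ((χ.zetaMul p).re / p) + 2 / (p : ℝ) ^ 2 := by
  obtain ⟨h8, h2⟩ := sum_prime_pow_le χ hχ hp A
  have hp0 : (0 : ℝ) < p := by exact_mod_cast hp.pos
  have hlam : (χ.zetaMul p).re = 1 + (χ p).re := by
    have h := SmoothEulerProduct.zetaMul_prime_pow_re χ hχ hp 1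
    rw [pow_one] at h
    rw [h, Finset.sum_range_succ, Finset.sum_range_one, pow_zero, pow_one]
  rcases SmoothEulerProduct.apply_re_trichotomy χ hχ p with hc | hc | hc
  · -- `χ(p) = 0`: `λ(p) = 1`
    rw [hlam, hc, add_zero]
    have : 0 ≤ 2 / (p : ℝ) ^ 2 := by positivity
    have h8' : (8 : ℝ) / p = 8 * (1 / p) := by ring
    linarith
  · -- `χ(p) = 1`: `λ(p) = 2`
    rw [hlam, hc]
    have : 0 ≤ 2 / (p : ℝ) ^ 2 := by positivity
    have h8' : (8 : ℝ) / p ≤ 8 * ((1 + 1) / p) := by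
      rw [div_le_iff₀ hp0]; field_simp; norm_num
    linarith
  · -- `χ(p) = -1`: `λ(p) = 0`
    rw [hlam, hc]
    have := h2 hc
    norm_num
    linarith

/-! ### The bands -/

/-- **Band cover.** For `q ≥ 1`, `c ≥ 0`, `K ≥ 1`: every `p` with `⌊q^{c/K}⌋ < p ≤ ⌊q^{c}⌋` lies in a band
`(⌊q^{c/m}⌋, ⌊q^{c/(m−1)}⌋]` with `2 ≤ m ≤ K` (take the least `k` with `⌊q^{c/(k+1)}⌋ < p`).
[folklore] -/
theorem exists_band {qr c : ℝ} {K : ℕ} (hK : 1 ≤ K) {p : ℕ}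
    (hlow : ⌊qr ^ (c / K)⌋₊ < p) (hhigh : p ≤ ⌊qr ^ c⌋₊) :
    ∃ m ∈ Icc 2 K, ⌊qr ^ (c / m)⌋₊ < p ∧ p ≤ ⌊qr ^ (c / ((m : ℝ) - 1))⌋₊ := by
  classical
  set a : ℕ → ℕ := fun j => ⌊qr ^ (c / ((j : ℝ) + 1))⌋₊ with ha
  have hP : ∃ j, a j < p := by
    refine ⟨K - 1, ?_⟩
    have : ((K - 1 : ℕ) : ℝ) + 1 = K := by rw [Nat.cast_sub hK]; push_cast; ring
    simp only [ha, this]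
    exact hlow
  set k := Nat.find hP with hk
  have hkP : a k < p := Nat.find_spec hP
  have hkmin : ∀ j < k, ¬ a j < p := fun j hj => Nat.find_min hP hj
  have hk0 : k ≠ 0 := by
    intro h0
    have h := hkP
    rw [h0] at h
    simp only [ha, Nat.cast_zero, zero_add, div_one] at h
    omega
  have hkK : k ≤ K - 1 := Nat.find_min' hP (by
    have : ((K - 1 : ℕ) : ℝ) + 1 = K := by rw [Nat.cast_sub hK]; push_cast; ring
    simp only [ha, this]
    exact hlow)
  refine ⟨k + 1, ?_, ?_, ?_⟩
  · rw [mem_Icc]; omega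
  · have : (((k + 1 : ℕ) : ℝ)) = (k : ℝ) + 1 := by push_cast; ring
    rw [this]; exact hkP
  · have hprev := hkmin (k - 1) (by omega)
    push Not at hprev
    have hcast : ((k + 1 : ℕ) : ℝ) - 1 = ((k - 1 : ℕ) : ℝ) + 1 := by
      rw [Nat.cast_sub (Nat.one_le_iff_ne_zero.2 hk0)]; push_cast; ring
    rw [hcast]
    exact hprev

/-- **The prime mass of `(q^{c/K}, q^{c}]` from band bounds**: if for `2 ≤ k ≤ K` the primes of the
band `(⌊q^{c/k}⌋, ⌊q^{c/(k−1)}⌋]` have `∑ λ(p)/p ≤ K₀ k/η^{1/k}` (`λ = 1∗χ`; Matomäki–Merikoski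
Lemma 4.1 (ii) / Tao–Teräväinen (3.14)), then for `η ≥ 1`,
`∑_{⌊q^{c/K}⌋ < p ≤ ⌊q^{c}⌋} λ(p)/p ≤ K₀ K²/η^{1/K}`. [cite: MatomakiMerikoski2023, Lemma 4.1] -/
theorem sum_bands_le {K₀ c : ℝ} (hK₀ : 0 ≤ K₀) {q : ℕ} {χ : DirichletCharacter ℂ q}
    (hχ : χ ^ 2 = 1) {η : ℝ} (hη : 1 ≤ η) {K : ℕ} (hK : 2 ≤ K)
    (hband : ∀ k : ℕ, 2 ≤ k → k ≤ K →
      ∑ p ∈ (Ioc ⌊(q : ℝ) ^ (c / k)⌋₊ ⌊(q : ℝ) ^ (c / ((k : ℝ) - 1))⌋₊).filter Nat.Prime,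
        (χ.zetaMul p).re / p ≤ K₀ * k / η ^ ((1 : ℝ) / k)) :
    ∑ p ∈ (Ioc ⌊(q : ℝ) ^ (c / K)⌋₊ ⌊(q : ℝ) ^ c⌋₊).filter Nat.Prime, (χ.zetaMul p).re / p ≤
      K₀ * K ^ 2 / η ^ ((1 : ℝ) / K) := by
  classical
  have hK1 : 1 ≤ K := by omega
  have hnn : ∀ p : ℕ, 0 ≤ (χ.zetaMul p).re / p := fun p =>
    div_nonneg (SmoothEulerProduct.zetaMul_re_nonneg χ hχ p) (Nat.cast_nonneg p)
  have hcover : ∀ p ∈ (Ioc ⌊(q : ℝ) ^ (c / K)⌋₊ ⌊(q : ℝ) ^ c⌋₊).filter Nat.Prime,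
      ∃ m ∈ Icc 2 K, p ∈ (Ioc ⌊(q : ℝ) ^ (c / m)⌋₊ ⌊(q : ℝ) ^ (c / ((m : ℝ) - 1))⌋₊).filter Nat.Prime := by
    intro p hp
    rw [mem_filter, mem_Ioc] at hp
    obtain ⟨m, hm, h1, h2⟩ := exists_band (qr := (q : ℝ)) (c := c) hK1 hp.1.1 hp.1.2
    exact ⟨m, hm, by rw [mem_filter, mem_Ioc]; exact ⟨⟨h1, h2⟩, hp.2⟩⟩
  refine (sum_le_sum_sum_of_cover _ _ _ _ hnn hcover).trans ?_
  have hη0 : 0 < η := by linarith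
  have hK0 : (0 : ℝ) < K := by exact_mod_cast (lt_of_lt_of_le (by norm_num) hK)
  have hterm : ∀ m ∈ Icc 2 K,
      ∑ p ∈ (Ioc ⌊(q : ℝ) ^ (c / m)⌋₊ ⌊(q : ℝ) ^ (c / ((m : ℝ) - 1))⌋₊).filter Nat.Prime,
        (χ.zetaMul p).re / p ≤ K₀ * K / η ^ ((1 : ℝ) / K) := by
    intro m hm
    rw [mem_Icc] at hm
    refine (hband m hm.1 hm.2).trans ?_
    have hm0 : (0 : ℝ) < m := by exact_mod_cast (lt_of_lt_of_le (by norm_num) hm.1)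
    have hmK : (m : ℝ) ≤ K := by exact_mod_cast hm.2
    have hpow : η ^ ((1 : ℝ) / K) ≤ η ^ ((1 : ℝ) / m) :=
      Real.rpow_le_rpow_of_exponent_le hη (div_le_div_of_nonneg_left zero_le_one hm0 hmK)
    have hpos : 0 < η ^ ((1 : ℝ) / K) := Real.rpow_pos_of_pos hη0 _
    calc K₀ * m / η ^ ((1 : ℝ) / m) ≤ K₀ * K / η ^ ((1 : ℝ) / m) := by gcongr
      _ ≤ K₀ * K / η ^ ((1 : ℝ) / K) := div_le_div_of_nonneg_left (by positivity) hpos hpow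
  calc ∑ m ∈ Icc 2 K, ∑ p ∈ (Ioc ⌊(q : ℝ) ^ (c / m)⌋₊ ⌊(q : ℝ) ^ (c / ((m : ℝ) - 1))⌋₊).filter
          Nat.Prime, (χ.zetaMul p).re / p
      ≤ ∑ m ∈ Icc 2 K, K₀ * K / η ^ ((1 : ℝ) / K) := Finset.sum_le_sum hterm
    _ = ((K + 1 - 2 : ℕ) : ℝ) * (K₀ * K / η ^ ((1 : ℝ) / K)) := by
        rw [Finset.sum_const, Nat.card_Icc, nsmul_eq_mul]
    _ ≤ (K : ℝ) * (K₀ * K / η ^ ((1 : ℝ) / K)) := by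
        refine mul_le_mul_of_nonneg_right ?_ (by positivity)
        exact_mod_cast (by omega : K + 1 - 2 ≤ K)
    _ = K₀ * K ^ 2 / η ^ ((1 : ℝ) / K) := by ring

/-! ### The flat range -/

/-- **The one-step comparison**: if `S₁ − S_M ≤ A + B` with `A ≤ (κ/8) S_M`, `B ≤ (κ/8) S₁`
(`0 < κ ≤ 1`, `S_M ≥ 0`), then `S₁ ≤ (1 + κ/2) S_M`. Pure bookkeeping. [folklore] -/
theorem step_le {SM S₁ A B κ : ℝ} (hκ : 0 < κ) (hκ1 : κ ≤ 1) (hSM : 0 ≤ SM)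
    (hdiff : S₁ - SM ≤ A + B) (hA : A ≤ κ / 8 * SM) (hB : B ≤ κ / 8 * S₁) :
    S₁ ≤ (1 + κ / 2) * SM := by
  have hpos : 0 < 1 - κ / 8 := by linarith
  have h1 : S₁ * (1 - κ / 8) ≤ (1 + κ / 8) * SM := by linarith
  have h2 : (1 + κ / 8) * SM ≤ (1 + κ / 2) * SM * (1 - κ / 8) := by
    have : 0 ≤ SM * (κ * (4 - κ)) := mul_nonneg hSM (mul_nonneg hκ.le (by linarith))
    nlinarith
  exact le_of_mul_le_mul_right (h1.trans h2) hpos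

/-- `100 ≤ e⁵`. [folklore] -/
theorem hundred_le_exp_five : (100 : ℝ) ≤ Real.exp 5 := by
  have h1 : (2.7 : ℝ) ≤ Real.exp 1 := by
    have := Real.exp_one_gt_d9; norm_num at this ⊢; linarith
  calc (100 : ℝ) ≤ 2.7 ^ 5 := by norm_num
    _ ≤ Real.exp 1 ^ 5 := pow_le_pow_left₀ (by norm_num) h1 5
    _ = Real.exp 5 := by rw [← Real.exp_nat_mul]; norm_num

set_option maxHeartbeats 1000000 in
/-- **The flat range of the harmonic sum at a Siegel zero.** For `0 < ε₁` and `0 < κ ≤ 1` there is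
`η₀` such that for every primitive quadratic `χ` mod `q`, every `η ≥ η₀` with `L(1 − 1/(η log q), χ) = 0`
and all naturals `q^{ε₁} ≤ M ≤ N`,
`∑_{n ≤ N} (1∗χ)(n)/n ≤ (1 + κ)(1 + 4(log N + 2)/(η log q)) ∑_{n ≤ M} (1∗χ)(n)/n`.
(For `M ≥ q^{0.505}` this is Tao–Teräväinen's (3.15)–(3.16), `SiegelZero.exists_harmSum_ratio_le`;
below, Rankin's trick and the band bounds (3.14) bridge `[M, ⌊q^{0.51}⌋]`.)
[cite: TaoTeravainen2021, §3.3 (3.14)–(3.16)] -/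
theorem exists_harmSum_le_of_flatRange {ε₁ κ : ℝ} (hε₁ : 0 < ε₁) (hκ : 0 < κ) (hκ1 : κ ≤ 1) :
    ∃ η₀ : ℝ, ∀ (q : ℕ) [NeZero q] (χ : DirichletCharacter ℂ q), χ.IsPrimitive → χ ^ 2 = 1 →
      ∀ η : ℝ, η₀ ≤ η → χ.LFunction ((1 - 1 / (η * Real.log q) : ℝ) : ℂ) = 0 →
        ∀ M N : ℕ, (q : ℝ) ^ ε₁ ≤ M → M ≤ N →
          ∑ n ∈ Icc 1 N, (χ.zetaMul n).re / n ≤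
            (1 + κ) * (1 + 4 * (Real.log N + 2) / (η * Real.log q)) *
              ∑ n ∈ Icc 1 M, (χ.zetaMul n).re / n := by
  classical
  -- constants
  obtain ⟨K₀, hK₀, hMM⟩ := MatomakiMerikoski2023_lemma41_second (δ := 1 / 100) (by norm_num)
  obtain ⟨ηT, hTT⟩ := exists_harmSum_ratio_le (ε := 1 / 100) (by norm_num)
  obtain ⟨η₁, hη₁, hlevel⟩ := SiegelZeroQuality.exists_eta_le_level
  obtain ⟨c, hc⟩ : ∃ c : ℝ, c = 1 / 2 + 1 / 100 := ⟨_, rfl⟩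
  have hc0 : 0 < c := by rw [hc]; norm_num
  have hc1 : c ≤ 1 := by rw [hc]; norm_num
  obtain ⟨K, hKdef⟩ : ∃ K : ℕ, K = ⌈2 * (24 + 16 / κ) / ε₁⌉₊ + 2 := ⟨_, rfl⟩
  have hK2 : 2 ≤ K := by rw [hKdef]; omega
  have hKr : 2 * (24 + 16 / κ) / ε₁ ≤ K := by
    rw [hKdef]; push_cast
    have := Nat.le_ceil (2 * (24 + 16 / κ) / ε₁)
    linarith
  have hK0 : (0 : ℝ) < K := by exact_mod_cast (lt_of_lt_of_le (by norm_num) hK2)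
  obtain ⟨Lth, hLth⟩ : ∃ Lth : ℝ, Lth = max 200 ((5 + 64 / κ) * K / c) := ⟨_, rfl⟩
  obtain ⟨ηB, hηB⟩ : ∃ ηB : ℝ, ηB = (128 * K₀ * K ^ 2 / κ) ^ (K : ℝ) := ⟨_, rfl⟩
  refine ⟨max (max (Real.exp Lth) ηB) (max (max 10 ηT) η₁), ?_⟩
  intro q _ χ hprim hχ η hη hL M N hM hMN
  /- sizes -/
  have hq2n : 2 ≤ q := two_le_of_LFunction_eq_zero hL
  have hq2 : (2 : ℝ) ≤ q := by exact_mod_cast hq2n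
  have hq0 : (0 : ℝ) < q := by linarith
  have hq1 : (1 : ℝ) ≤ q := by linarith
  have hquad : χ.IsQuadratic := MulChar.isQuadratic_iff_sq_eq_one.mpr hχ
  have hη10 : 10 ≤ η := ((le_max_left _ _).trans ((le_max_left _ _).trans (le_max_right _ _))).trans hη
  have hηT : ηT ≤ η := ((le_max_right _ _).trans ((le_max_left _ _).trans (le_max_right _ _))).trans hη
  have hηη₁ : η₁ ≤ η := ((le_max_right _ _).trans (le_max_right _ _)).trans hη
  have hηexp : Real.exp Lth ≤ η := ((le_max_left _ _).trans (le_max_left _ _)).trans hη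
  have hηBle : ηB ≤ η := ((le_max_right _ _).trans (le_max_left _ _)).trans hη
  have hη1 : 1 ≤ η := by linarith
  have hη0 : 0 < η := by linarith
  have hηq : η ≤ q := hlevel q χ hprim hquad hq2n η hηη₁ hL
  obtain ⟨L, hLdef⟩ : ∃ L : ℝ, L = Real.log q := ⟨_, rfl⟩
  have hL0 : 0 < L := by rw [hLdef]; exact Real.log_pos (by linarith)
  have hLth' : Lth ≤ L := by
    have h1 : Real.exp Lth ≤ q := hηexp.trans hηq
    rw [hLdef, ← Real.log_exp Lth]; exact Real.log_le_log (Real.exp_pos _) h1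
  rw [hLth] at hLth'
  have hL200 : 200 ≤ L := (le_max_left _ _).trans hLth'
  have hLK : (5 + 64 / κ) * K / c ≤ L := (le_max_right _ _).trans hLth'
  -- the small exponent `e = c/K` and `w`
  obtain ⟨e, he⟩ : ∃ e : ℝ, e = c / K := ⟨_, rfl⟩
  have he0 : 0 < e := by rw [he]; positivity
  have heL : 5 + 64 / κ ≤ e * L := by
    have h1 : (5 + 64 / κ) * K ≤ L * c := (div_le_iff₀ hc0).1 hLK
    rw [he, div_mul_eq_mul_div, le_div_iff₀ hK0]
    linarith
  have hκ64 : 0 ≤ 64 / κ := by positivity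
  have heL5 : 5 ≤ e * L := by linarith
  obtain ⟨w, hw⟩ : ∃ w : ℕ, w = ⌊(q : ℝ) ^ e⌋₊ + 1 := ⟨_, rfl⟩
  have hqe : (q : ℝ) ^ e = Real.exp (e * L) := by
    rw [Real.rpow_def_of_pos hq0, hLdef]; ring_nf
  have hqe100 : (100 : ℝ) ≤ (q : ℝ) ^ e := by
    rw [hqe]; exact hundred_le_exp_five.trans (Real.exp_le_exp.2 heL5)
  have hfloor : (q : ℝ) ^ e - 1 < ⌊(q : ℝ) ^ e⌋₊ := Nat.sub_one_lt_floor _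
  have hw100 : 100 ≤ w := by
    have h1 : (99 : ℝ) < ⌊(q : ℝ) ^ e⌋₊ := by linarith
    have h2 : (99 : ℕ) < ⌊(q : ℝ) ^ e⌋₊ := by exact_mod_cast h1
    rw [hw]; omega
  have hw2 : 2 ≤ w := by omega
  have hw0 : (0 : ℝ) < w := by exact_mod_cast (lt_of_lt_of_le (by norm_num) hw100)
  have hwr : (w : ℝ) ≤ 2 * (q : ℝ) ^ e := by
    rw [hw]; push_cast
    have := Nat.floor_le (Real.rpow_nonneg hq0.le e)
    linarith
  have hwge : (q : ℝ) ^ e ≤ w := by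
    rw [hw]; push_cast; exact (Nat.lt_floor_add_one _).le
  have hlogw : Real.log w ≤ 2 * (e * L) := by
    have h1 : Real.log w ≤ Real.log (2 * (q : ℝ) ^ e) := Real.log_le_log hw0 hwr
    have h2 : Real.log (2 * (q : ℝ) ^ e) = Real.log 2 + e * L := by
      rw [Real.log_mul (by norm_num) (by positivity), hqe, Real.log_exp]
    have h3 : Real.log 2 ≤ 1 := by have := Real.log_two_lt_d9; linarith
    linarith
  have hlogw0 : 0 < Real.log w := Real.log_pos (by exact_mod_cast (lt_of_lt_of_le (by norm_num) hw100))
  -- `4/w ≤ κ/16`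
  have hwκ : (2 : ℝ) * (2 * (2 / w)) ≤ κ / 8 / 2 * 2 := by
    have h64 : 64 / κ ≤ (w : ℝ) := by
      have h1 : 64 / κ ≤ e * L := by linarith
      have h2 : e * L ≤ Real.exp (e * L) := by have := Real.add_one_le_exp (e * L); linarith
      rw [hqe] at hwge
      linarith
    have h4 : (4 : ℝ) / w ≤ 4 / (64 / κ) := div_le_div_of_nonneg_left (by norm_num) (by positivity) h64
    have h5 : (4 : ℝ) / (64 / κ) = κ / 16 := by field_simp; ring
    have h6 : (2 : ℝ) * (2 * (2 / w)) = 8 / w := by ring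
    have h7 : (8 : ℝ) / w = 2 * (4 / w) := by ring
    rw [h6, h7]
    linarith
  /- the harmonic sums -/
  set S : ℕ → ℝ := fun N => ∑ n ∈ Icc 1 N, (χ.zetaMul n).re / n with hSdef
  have hSmono : ∀ {a b : ℕ}, a ≤ b → S a ≤ S b := fun h => harmSum_mono χ hχ h
  have hM1 : 1 ≤ M := by
    have : (0 : ℝ) < M := lt_of_lt_of_le (Real.rpow_pos_of_pos hq0 _) hM
    exact_mod_cast this
  have hSM1 : 1 ≤ S M := one_le_harmSum χ hχ hM1
  have hSM0 : 0 ≤ S M := by linarith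
  obtain ⟨N₁, hN₁⟩ : ∃ N₁ : ℕ, N₁ = ⌊(q : ℝ) ^ c⌋₊ := ⟨_, rfl⟩
  -- `N₁ ≥ q^{0.505}`
  have hN₁ge : (q : ℝ) ^ ((1 + 1 / 100) / 2 : ℝ) ≤ N₁ := by
    have h1 : (q : ℝ) ^ c - 1 < N₁ := by rw [hN₁]; exact Nat.sub_one_lt_floor _
    have hsplit : (q : ℝ) ^ c = (q : ℝ) ^ ((1 + 1 / 100) / 2 : ℝ) * (q : ℝ) ^ (1 / 200 : ℝ) := by
      rw [← Real.rpow_add hq0, hc]; norm_num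
    have h200 : (2 : ℝ) ≤ (q : ℝ) ^ (1 / 200 : ℝ) := by
      rw [Real.rpow_def_of_pos hq0, ← hLdef]
      have : Real.log 2 ≤ L * (1 / 200) := by
        have := Real.log_two_lt_d9; linarith
      calc (2 : ℝ) = Real.exp (Real.log 2) := (Real.exp_log two_pos).symm
        _ ≤ Real.exp (L * (1 / 200)) := Real.exp_le_exp.2 this
    have hb : (1 : ℝ) ≤ (q : ℝ) ^ ((1 + 1 / 100) / 2 : ℝ) := Real.one_le_rpow hq1 (by norm_num)
    have h3 : (q : ℝ) ^ ((1 + 1 / 100) / 2 : ℝ) + 1 ≤ (q : ℝ) ^ c := by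
      rw [hsplit]
      calc (q : ℝ) ^ ((1 + 1 / 100) / 2 : ℝ) + 1
          ≤ (q : ℝ) ^ ((1 + 1 / 100) / 2 : ℝ) + (q : ℝ) ^ ((1 + 1 / 100) / 2 : ℝ) := by linarith
        _ = (q : ℝ) ^ ((1 + 1 / 100) / 2 : ℝ) * 2 := by ring
        _ ≤ (q : ℝ) ^ ((1 + 1 / 100) / 2 : ℝ) * (q : ℝ) ^ (1 / 200 : ℝ) :=
            mul_le_mul_of_nonneg_left h200 (by linarith)
    linarith
  /- Claim: `M ≤ N₁ → S N₁ ≤ (1 + κ/2) S M` -/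
  have hclaim : M ≤ N₁ → S N₁ ≤ (1 + κ / 2) * S M := by
    intro hMN₁
    have hdiff : S N₁ - S M = ∑ n ∈ Ioc M N₁, (χ.zetaMul n).re / n := harmSum_sub_harmSum χ hMN₁
    rw [← Finset.sum_filter_add_sum_filter_not (Ioc M N₁) (· ∈ w.smoothNumbers)] at hdiff
    -- (a) the smooth part
    have hsmall : Real.exp 24 * (M : ℝ) ^ (-(1 / Real.log w)) ≤ κ / 16 := by
      have hM0 : (0 : ℝ) < M := by exact_mod_cast hM1
      have hlogM : ε₁ * L ≤ Real.log M := by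
        have := Real.log_le_log (Real.rpow_pos_of_pos hq0 ε₁) hM
        rwa [Real.log_rpow hq0, ← hLdef] at this
      have hexpM : (M : ℝ) ^ (-(1 / Real.log w)) ≤ Real.exp (-(ε₁ * K / (2 * c))) := by
        rw [Real.rpow_def_of_pos hM0, Real.exp_le_exp]
        have h1 : Real.log M * (-(1 / Real.log w)) = -(Real.log M / Real.log w) := by ring
        rw [h1, neg_le_neg_iff, le_div_iff₀ hlogw0]
        have h2 : ε₁ * K / (2 * c) * Real.log w ≤ ε₁ * K / (2 * c) * (2 * (e * L)) :=
          mul_le_mul_of_nonneg_left hlogw (by positivity)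
        have h3 : ε₁ * K / (2 * c) * (2 * (e * L)) = ε₁ * L := by
          rw [he]; field_simp
        linarith
      have hKε : 24 + 16 / κ ≤ ε₁ * K / (2 * c) := by
        have h1 : 2 * (24 + 16 / κ) ≤ K * ε₁ := (div_le_iff₀ hε₁).1 hKr
        rw [le_div_iff₀ (by positivity)]
        have hpos : 0 ≤ 24 + 16 / κ := by positivity
        have h2 : (24 + 16 / κ) * (2 * c) ≤ (24 + 16 / κ) * 2 :=
          mul_le_mul_of_nonneg_left (by linarith) hpos
        linarith
      have h16 : Real.exp 24 * Real.exp (-(ε₁ * K / (2 * c))) ≤ κ / 16 := by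
        rw [← Real.exp_add]
        have h1 : 24 + -(ε₁ * K / (2 * c)) ≤ -(16 / κ) := by linarith
        calc Real.exp (24 + -(ε₁ * K / (2 * c))) ≤ Real.exp (-(16 / κ)) := Real.exp_le_exp.2 h1
          _ ≤ κ / 16 := by
              rw [Real.exp_neg, inv_le_comm₀ (Real.exp_pos _) (by positivity), inv_div]
              have := Real.add_one_le_exp (16 / κ)
              linarith
      calc Real.exp 24 * (M : ℝ) ^ (-(1 / Real.log w))
          ≤ Real.exp 24 * Real.exp (-(ε₁ * K / (2 * c))) :=
            mul_le_mul_of_nonneg_left hexpM (Real.exp_pos _).le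
        _ ≤ κ / 16 := h16
    have hA : ∑ n ∈ (Ioc M N₁).filter (· ∈ w.smoothNumbers), (χ.zetaMul n).re / n ≤ κ / 8 * S M := by
      have h1 := sum_Ioc_smooth_le χ hχ hw100 hM1 N₁
      have h2 := smoothProduct_le_two_mul χ hχ hw100 hM1 (hsmall.trans (by linarith))
      have hP0 : 0 ≤ Real.exp 24 * (M : ℝ) ^ (-(1 / Real.log w)) := by positivity
      calc _ ≤ Real.exp 24 * (M : ℝ) ^ (-(1 / Real.log w)) *
            ∏ p ∈ w.primesBelow, (1 - (p : ℝ)⁻¹)⁻¹ * (1 - (χ p).re * (p : ℝ)⁻¹)⁻¹ := h1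
        _ ≤ Real.exp 24 * (M : ℝ) ^ (-(1 / Real.log w)) * (2 * S M) := mul_le_mul_of_nonneg_left h2 hP0
        _ ≤ κ / 16 * (2 * S M) := mul_le_mul_of_nonneg_right hsmall (by positivity)
        _ = κ / 8 * S M := by ring
    -- (b) the rough part
    have hB : ∑ n ∈ (Ioc M N₁).filter (· ∉ w.smoothNumbers), (χ.zetaMul n).re / n ≤ κ / 8 * S N₁ := by
      have h1 := sum_Ioc_rough_le χ hχ w M N₁
      have hcoef : ∑ p ∈ (Icc w N₁).filter Nat.Prime, ∑ a ∈ Icc 1 N₁, (χ.zetaMul (p ^ a)).re / (p : ℝ) ^ a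
          ≤ κ / 8 := by
        have hpt : ∀ p ∈ (Icc w N₁).filter Nat.Prime,
            ∑ a ∈ Icc 1 N₁, (χ.zetaMul (p ^ a)).re / (p : ℝ) ^ a ≤
              8 * ((χ.zetaMul p).re / p) + 2 / (p : ℝ) ^ 2 := fun p hp =>
          sum_prime_pow_le_charDivisorSum χ hχ (mem_filter.1 hp).2 N₁
        refine (Finset.sum_le_sum hpt).trans ?_
        rw [Finset.sum_add_distrib, ← Finset.mul_sum]
        -- the `λ(p)/p` part: the bands
        have hbands : ∑ p ∈ (Icc w N₁).filter Nat.Prime, (χ.zetaMul p).re / p ≤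
            K₀ * K ^ 2 / η ^ ((1 : ℝ) / K) := by
          have hIcc : Icc w N₁ = Ioc ⌊(q : ℝ) ^ (c / K)⌋₊ ⌊(q : ℝ) ^ c⌋₊ := by
            rw [hw, hN₁, he]; ext n; simp only [mem_Icc, mem_Ioc]; omega
          rw [hIcc]
          refine sum_bands_le (K₀ := K₀) hK₀.le hχ hη1 hK2 fun k hk _ => ?_
          have h := hMM q χ hprim hquad η hη10 hL k hk
          have heq : ∀ p : ℕ, RealChar.charDivisorSum χ p / p = (χ.zetaMul p).re / p := fun p => by
            rw [RealChar.charDivisorSum_eq_zetaMul_re χ hχ]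
          simp only [heq, ← hc] at h
          exact h
        have hbands' : 8 * ∑ p ∈ (Icc w N₁).filter Nat.Prime, (χ.zetaMul p).re / p ≤ κ / 16 := by
          have hbase : 0 ≤ 128 * K₀ * K ^ 2 / κ := by positivity
          have hηK : 128 * K₀ * K ^ 2 / κ ≤ η ^ ((1 : ℝ) / K) := by
            have h1 : (128 * K₀ * K ^ 2 / κ) = ((128 * K₀ * K ^ 2 / κ) ^ (K : ℝ)) ^ ((1 : ℝ) / K) := by
              rw [← Real.rpow_mul hbase, mul_one_div_cancel hK0.ne', Real.rpow_one]
            rw [h1, ← hηB]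
            exact Real.rpow_le_rpow (by rw [hηB]; positivity) hηBle (by positivity)
          have hpos : 0 < η ^ ((1 : ℝ) / K) := Real.rpow_pos_of_pos hη0 _
          have h2 : K₀ * K ^ 2 / η ^ ((1 : ℝ) / K) ≤ κ / 128 := by
            rw [div_le_iff₀ hpos]
            have h3 : 128 * K₀ * K ^ 2 ≤ η ^ ((1 : ℝ) / K) * κ := (div_le_iff₀ hκ).1 hηK
            have h4 : κ / 128 * η ^ ((1 : ℝ) / K) = η ^ ((1 : ℝ) / K) * κ / 128 := by ring
            rw [h4]; linarith
          linarith
        -- the `1/p²` part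
        have hsq : ∑ p ∈ (Icc w N₁).filter Nat.Prime, (2 : ℝ) / (p : ℝ) ^ 2 ≤ κ / 16 := by
          have h1 : ∑ p ∈ (Icc w N₁).filter Nat.Prime, (2 : ℝ) / (p : ℝ) ^ 2 ≤
              ∑ n ∈ Icc w N₁, (2 : ℝ) / (n : ℝ) ^ 2 :=
            Finset.sum_le_sum_of_subset_of_nonneg (Finset.filter_subset _ _) fun n _ _ => by positivity
          have h2 : ∑ n ∈ Icc w N₁, (2 : ℝ) / (n : ℝ) ^ 2 = 2 * ∑ n ∈ Icc w N₁, (1 : ℝ) / (n : ℝ) ^ 2 := by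
            rw [Finset.mul_sum]; refine Finset.sum_congr rfl fun n _ => ?_; ring
          have h3 := sum_inv_sq_Icc_le hw2 N₁
          have h4 : 2 * ∑ n ∈ Icc w N₁, (1 : ℝ) / (n : ℝ) ^ 2 ≤ 2 * (2 / w) :=
            mul_le_mul_of_nonneg_left h3 (by norm_num)
          linarith
        linarith
      have hSN0 : 0 ≤ S N₁ := le_trans hSM0 (hSmono hMN₁)
      exact h1.trans (mul_le_mul_of_nonneg_right hcoef hSN0)
    exact step_le hκ hκ1 hSM0 (le_of_eq hdiff) hA hB
  /- conclusion -/
  rw [← hLdef]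
  have hlogN : 0 ≤ Real.log N := by
    have hN1 : (1 : ℝ) ≤ N := by exact_mod_cast (hM1.trans hMN)
    exact Real.log_nonneg hN1
  have hηL : 0 < η * L := by positivity
  have hF0 : 0 ≤ 4 * (Real.log N + 2) / (η * L) := by positivity
  have hTT' : ∀ M' : ℕ, (q : ℝ) ^ ((1 + 1 / 100) / 2 : ℝ) ≤ M' → M' ≤ N →
      S N ≤ (1 + 4 * (Real.log N + 2) / (η * L)) * S M' := by
    intro M' hM' hM'N
    obtain ⟨hpos, h⟩ := hTT q χ hprim hχ η hηT hL M' N hM' hM'N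
    rw [← hLdef] at h
    have hM'1 : (1 : ℝ) ≤ M' := le_trans (Real.one_le_rpow hq1 (by norm_num)) hM'
    have hlogM' : 0 ≤ Real.log M' := Real.log_nonneg hM'1
    have hSM'0 : 0 ≤ S M' := hpos.le
    have h1 : S N - S M' ≤ 4 * (Real.log N - Real.log M' + 2) * S M' / (η * L) := by
      rw [le_div_iff₀ hηL]; exact h
    have h2 : 4 * (Real.log N - Real.log M' + 2) * S M' ≤ 4 * (Real.log N + 2) * S M' :=
      mul_le_mul_of_nonneg_right (by linarith) hSM'0
    have h3 : 4 * (Real.log N - Real.log M' + 2) * S M' / (η * L) ≤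
        4 * (Real.log N + 2) * S M' / (η * L) := div_le_div_of_nonneg_right h2 hηL.le
    have h4 : 4 * (Real.log N + 2) * S M' / (η * L) = 4 * (Real.log N + 2) / (η * L) * S M' := by ring
    linarith
  have hfin : ∀ {T : ℝ}, S N ≤ T * S M → 0 ≤ T → T ≤ (1 + κ) * (1 + 4 * (Real.log N + 2) / (η * L)) →
      S N ≤ (1 + κ) * (1 + 4 * (Real.log N + 2) / (η * L)) * S M := by
    intro T h1 _ h3
    exact h1.trans (mul_le_mul_of_nonneg_right h3 hSM0)
  rcases le_or_gt M N₁ with hMN₁ | hMN₁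
  · have hS₁ := hclaim hMN₁
    rcases le_or_gt N₁ N with hN₁N | hN₁N
    · have h := hTT' N₁ hN₁ge hN₁N
      have h2 : S N ≤ (1 + 4 * (Real.log N + 2) / (η * L)) * (1 + κ / 2) * S M := by
        calc S N ≤ (1 + 4 * (Real.log N + 2) / (η * L)) * S N₁ := h
          _ ≤ (1 + 4 * (Real.log N + 2) / (η * L)) * ((1 + κ / 2) * S M) :=
              mul_le_mul_of_nonneg_left hS₁ (by linarith)
          _ = _ := by ring
      refine hfin h2 (by positivity) ?_
      have : (1 + 4 * (Real.log N + 2) / (η * L)) * (1 + κ / 2) ≤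
          (1 + 4 * (Real.log N + 2) / (η * L)) * (1 + κ) :=
        mul_le_mul_of_nonneg_left (by linarith) (by linarith)
      linarith
    · -- `N < N₁`: monotonicity
      have h2 : S N ≤ (1 + κ / 2) * S M := (hSmono hN₁N.le).trans hS₁
      refine hfin h2 (by linarith) ?_
      have : (1 : ℝ) * (1 + κ / 2) ≤ (1 + 4 * (Real.log N + 2) / (η * L)) * (1 + κ) :=
        mul_le_mul (by linarith) (by linarith) (by linarith) (by linarith)
      linarith
  · -- `M > N₁ ≥ q^{0.505}`: Tao–Teräväinen directly
    have hM' : (q : ℝ) ^ ((1 + 1 / 100) / 2 : ℝ) ≤ M := hN₁ge.trans (by exact_mod_cast hMN₁.le)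
    have h := hTT' M hM' hMN
    refine hfin h (by linarith) ?_
    have : (1 : ℝ) * (1 + 4 * (Real.log N + 2) / (η * L)) ≤
        (1 + κ) * (1 + 4 * (Real.log N + 2) / (η * L)) :=
      mul_le_mul_of_nonneg_right (by linarith) (by linarith)
    linarith

end HarmFlat

end Literature.NumberTheory.LFunctions.SiegelZero
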